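import Summits.Parity.GeneralizedHardyLittlewood.Theorems.PrimeLevelFamEdgeMomentsBeyondDiagonalTwoOrderWeightBounds
import HarnessLib

/-!
# Route `PrimeLevelFamEdge`, crux K_A `MomentsBeyondDiagonal` (stmt-Parity-20007), line «petersson_layers» v4:
# decay of the first-moment AFE weight `V_k(q̂; n) = ∫_{n/q̂}^∞ e^{−x}(log(q̂/n) + log x)^k dx` (helper for `stub_first` at every `Q`)

The weight of the exact first-moment AFE at order `k` (`…FirstOrderAFE`, `…FirstOrderDictionary`) decays faster than
any power beyond `n ≍ q̂`, with the usual logarithmic factor: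
* `abs_firstAfeV_le`: `|V_k(q̂;n)| ≤ C_{A,k} (1 + |log(q̂/n)|)^k (q̂/n)^A` for every `A ≥ 0`, `n ≥ 1`, `q̂ > 0`
  (`C_{A,k} = ∫_0^∞ x^A e^{−x} 2^k (1+|log x|^k) dx`; Rankin's trick, the tree's `integral_abs_inner_tail_le` /
  `integral_rpow_exp_abs_log_pow_le`);
* `abs_firstAfeV_le_logsep`: the same with `(1+|log(q̂/n)|)^k ≤ (1+log q̂)^k (1+log n)^k` for `q̂ ≥ 1`.
These are the `n`-side inputs of the two `J`-estimates and of the diagonal evaluation that remain for `stub_first` (census in the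
crux item's evidence). Proof only; K_A NOT proved.
-/

noncomputable section

open scoped Real
open MeasureTheory Set
open Literature.NumberTheory.LFunctions Literature.NumberTheory.LFunctions.KMV2000

namespace Summit.Parity.GeneralizedHardyLittlewood.Theorems.MomentsBeyondDiagonal.FirstOrderAFE

/-- **Decay of `V_k(q̂;n)`**: `|∫_{n/q̂}^∞ e^{−x}(log(q̂/n)+log x)^k dx| ≤ C_{A,k} (1+|log(q̂/n)|)^k (q̂/n)^A` (`A ≥ 0`, `n ≥ 1`,
`q̂ > 0`). [cite: KowalskiMichelVanderKam2000, (13)–(15) p. 9] -/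
theorem abs_firstAfeV_le {qh : ℝ} (hqh : 0 < qh) (k : ℕ) {A : ℝ} (hA : 0 ≤ A) {n : ℕ} (hn : n ≠ 0) :
    |∫ x in Ioi ((n : ℝ) / qh), Real.exp (-x) * (Real.log (qh / n) + Real.log x) ^ k| ≤
      (∫ x in Ioi (0 : ℝ), x ^ A * (Real.exp (-x) * (2 ^ k * (1 + |Real.log x| ^ k)))) *
        (1 + |Real.log (qh / n)|) ^ k * (qh / n) ^ A := by
  have hn0 : (0 : ℝ) < n := by exact_mod_cast Nat.pos_of_ne_zero hn
  have hy : 0 < (n : ℝ) / qh := div_pos hn0 hqh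
  set a : ℝ := Real.log (qh / n) with ha
  -- `|V| ≤ ∫ e^{-x}|a + log x|^k` over the tail
  have h1 : |∫ x in Ioi ((n : ℝ) / qh), Real.exp (-x) * (a + Real.log x) ^ k| ≤
      ∫ x in Ioi ((n : ℝ) / qh), Real.exp (-x) * |a + Real.log x| ^ k := by
    calc |∫ x in Ioi ((n : ℝ) / qh), Real.exp (-x) * (a + Real.log x) ^ k|
        ≤ ∫ x in Ioi ((n : ℝ) / qh), |Real.exp (-x) * (a + Real.log x) ^ k| := by
          rw [← Real.norm_eq_abs]
          exact (norm_integral_le_integral_norm _).trans (le_of_eq rfl)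
      _ = ∫ x in Ioi ((n : ℝ) / qh), Real.exp (-x) * |a + Real.log x| ^ k := by
          refine setIntegral_congr_fun measurableSet_Ioi fun x _ ↦ ?_
          rw [abs_mul, abs_of_pos (Real.exp_pos _), abs_pow]
  -- Rankin with `x₁ = 1`, `y = n/q̂`
  have h2 := integral_abs_inner_tail_le a k hA hy one_pos
  rw [div_one] at h2
  obtain ⟨-, h3⟩ := integral_rpow_exp_abs_log_pow_le a k hA
  have hC : 0 ≤ ∫ x in Ioi (0 : ℝ), x ^ A * (Real.exp (-x) * (2 ^ k * (1 + |Real.log x| ^ k))) :=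
    setIntegral_nonneg measurableSet_Ioi fun x hx ↦ by have hx : (0 : ℝ) < x := hx; positivity
  have hpow : (1 / ((n : ℝ) / qh)) ^ A = (qh / n) ^ A := by rw [one_div, inv_div]
  calc |∫ x in Ioi ((n : ℝ) / qh), Real.exp (-x) * (a + Real.log x) ^ k|
      ≤ ∫ x in Ioi ((n : ℝ) / qh), Real.exp (-x) * |a + Real.log x| ^ k := h1
    _ ≤ (1 / ((n : ℝ) / qh)) ^ A * ∫ x in Ioi (0 : ℝ), x ^ A * (Real.exp (-x) * |a + Real.log x| ^ k) := h2
    _ ≤ (qh / n) ^ A * ((1 + |a|) ^ k * ∫ x in Ioi (0 : ℝ), x ^ A * (Real.exp (-x) * (2 ^ k * (1 + |Real.log x| ^ k)))) := by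
        rw [hpow]
        exact mul_le_mul_of_nonneg_left h3 (Real.rpow_nonneg (div_pos hqh hn0).le A)
    _ = _ := by ring

/-- **Log-separated form**: for `q̂ ≥ 1`, `|V_k(q̂;n)| ≤ C_{A,k} (1+log q̂)^k (1+log n)^k (q̂/n)^A`.
[cite: KowalskiMichelVanderKam2000, (13)–(15) p. 9] -/
theorem abs_firstAfeV_le_logsep {qh : ℝ} (hqh : 1 ≤ qh) (k : ℕ) {A : ℝ} (hA : 0 ≤ A) {n : ℕ} (hn : n ≠ 0) :
    |∫ x in Ioi ((n : ℝ) / qh), Real.exp (-x) * (Real.log (qh / n) + Real.log x) ^ k| ≤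
      (∫ x in Ioi (0 : ℝ), x ^ A * (Real.exp (-x) * (2 ^ k * (1 + |Real.log x| ^ k)))) *
        ((1 + Real.log qh) ^ k * (1 + Real.log n) ^ k) * (qh / n) ^ A := by
  have hq0 : 0 < qh := by linarith
  have h := abs_firstAfeV_le hq0 k hA hn
  have hl := TwoOrderAFE.one_add_abs_log_div_le hqh hn
  have ha0 : 0 ≤ 1 + |Real.log (qh / n)| := by positivity
  have hp : (1 + |Real.log (qh / n)|) ^ k ≤ (1 + Real.log qh) ^ k * (1 + Real.log n) ^ k := by
    rw [← mul_pow]; exact pow_le_pow_left₀ ha0 hl k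
  have hC : 0 ≤ ∫ x in Ioi (0 : ℝ), x ^ A * (Real.exp (-x) * (2 ^ k * (1 + |Real.log x| ^ k))) :=
    setIntegral_nonneg measurableSet_Ioi fun x hx ↦ by have hx : (0 : ℝ) < x := hx; positivity
  have hn0 : (0 : ℝ) < n := by exact_mod_cast Nat.pos_of_ne_zero hn
  have hy : 0 ≤ (qh / n) ^ A := Real.rpow_nonneg (div_pos hq0 hn0).le A
  calc _ ≤ _ := h
    _ ≤ _ := by
        exact mul_le_mul_of_nonneg_right (mul_le_mul_of_nonneg_left hp hC) hy

end Summit.Parity.GeneralizedHardyLittlewood.Theorems.MomentsBeyondDiagonal.FirstOrderAFE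

end
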